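import Literature.NumberTheory.GaloisRepresentations.CliffordConstituentGeometric
import Literature.NumberTheory.GaloisRepresentations.ArtinRestriction
import Literature.NumberTheory.PAdicHodge.DeRhamBaseChangeProofs
import Summits.Langlands.Langlands.Theorems.CliffordTateStructureInducedFrame
import HarnessLib

/-!
# Clifford–Tate structure, case A: a proper system of imprimitivity makes `ρ` INDUCED

Second half of the "induced" branch of the Clifford–Tate structure theorem
(`Summit.Langlands.Langlands.Theses.MonodromyDichotomy.CliffordTateStructure`, LEFT disjunct).
Let `ρ : Γ_K → GL_n(ℚ̄_ℓ)` be an irreducible geometric framed Galois representation of a number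
field `K` and `(U, H)` a system of imprimitivity for `ρ` with `H ≤ Γ_K` OPEN and PROPER
(`ρ(g) U = U ↔ g ∈ H`, translates independent and spanning; produced by Clifford theory in
`CliffordTateStructureCliffordCore`).  Then (`exists_induce_of_imprimitivity`) there are a number
field `L = K̄^H` with `[L : K] = [Γ_K : H] ≥ 2` and an IRREDUCIBLE GEOMETRIC `σ : Γ_L → GL_m(ℚ̄_ℓ)`,
`n = [L : K] m`, with `charpoly ρ(g) = charpoly Ind_{Γ_L}^{Γ_K}(σ)(g)` for all `g`.

* §1 `exists_restrictField_eq_reindex_fromBlocks_corner`: for ANY finite `L/K` (not necessarily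
  Galois) the restriction `Ind(σ)|_{Γ_L}` is block upper-triangular with corner the conjugate
  `σ^{σ₀}` at the trivial coset (Mackey at the identity double coset).
* §2 `isUnramifiedAt_and_isDeRhamFramed_of_conj_eq_reindex_comp_indMatrix`: hence `σ` inherits
  unramifiedness a.e. and de Rham-ness at `ℓ` from `ρ` (corner heredity,
  `PstWeilDeligneData.isDeRhamFramed_blocks`; base change `DeRhamBaseChange_holds`) — the tree's
  `isUnramifiedAt_and_isDeRhamFramed_of_conj_eq_reindex_induce` minus its `IsGalois` hypothesis.
* §3 `exists_induce_of_imprimitivity`: `L := fixedField H`, the stabiliser of the translate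
  `ρ(g) U` is `res(Γ_L)` (`exists_mem_range_absGaloisRestrict_fixedField_iff`), and
  `exists_conj_eq_reindex_comp_indMatrix_of_isInducedFrom` gives the conjugacy to `Ind(σ)`.
[cite: Clifford1937, Thm. 1–2] [cite: SerreLinearRepresentations1977, §7.1–7.2]
[cite: SerreAbelianLadic1968, Ch. I §2.1] [cite: FontaineAsterisque223III, Exp. III Prop. 1.5.2]
-/

set_option autoImplicit false
set_option linter.dupNamespace false

noncomputable section

namespace Summit.Langlands.Langlands.Theorems

open Filter NumberField IsDedekindDomain Field
open Literature.NumberTheory.Automorphic Literature.NumberTheory.GaloisRepresentations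
open Literature.NumberTheory.PAdicHodge
open scoped MatrixGroups

/-! ### §1 Restriction of an induced representation to the inducing field: the corner -/

section Corner

variable (K L : Type) [Field K] [NumberField K] [Field L] [NumberField L] [Algebra K L]

set_option backward.isDefEq.respectTransparency false in
/-- **`Ind(σ)|_{Γ_L}` is block upper triangular with corner `σ^{σ₀}`** — no Galois hypothesis.
If `R(x) = e·(σ̇(tᵢ⁻¹ x tⱼ))ᵢⱼ·e⁻¹` for a family `t` injective on cosets mod `res(Γ_L)` and
`res σ₀ = t_{i₀}`, then `R(res σ) = E·(σ(σ₀⁻¹ σ σ₀) B(σ); 0 D(σ))·E⁻¹` for some `q`,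
`E : Fin m ⊕ Fin q ≃ Fin n` and a framed `D` (block column `i₀` vanishes off the diagonal since
`tᵢ⁻¹ res(σ) t_{i₀} ∈ res(Γ_L)` forces `tᵢ ∈ res(Γ_L)`, i.e. `i = i₀`).
[cite: SerreLinearRepresentations1977, §7.2 Prop. 22] [cite: SerreAbelianLadic1968, Ch. I §2.1] -/
theorem exists_restrictField_eq_reindex_fromBlocks_corner
    {A : Type*} [CommRing A] [TopologicalSpace A] [IsTopologicalRing A] {n m : ℕ}
    (R : FramedGaloisRep K A n) (s : FramedGaloisRep L A m)
    {ι : Type*} [Fintype ι] [DecidableEq ι] (t : ι → absoluteGaloisGroup K)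
    (htinj : Function.Injective fun i =>
      (t i : absoluteGaloisGroup K ⧸ (absGaloisRestrict K L).toMonoidHom.range))
    (e : ι × Fin m ≃ Fin n)
    (hR : ∀ x : absoluteGaloisGroup K, ((R x : GL (Fin n) A) : Matrix (Fin n) (Fin n) A) =
      Matrix.reindex e e (Matrix.comp ι ι (Fin m) (Fin m) A
        (indMatrix (absGaloisRestrict K L).toMonoidHom (FramedRep.toMatrixHom s) t x)))
    {i₀ : ι} {σ₀ : absoluteGaloisGroup L} (hσ₀ : absGaloisRestrict K L σ₀ = t i₀) :
    ∃ (q : ℕ) (E : Fin m ⊕ Fin q ≃ Fin n) (D : FramedGaloisRep L A q),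
      ∀ σ : absoluteGaloisGroup L, ∃ B : Matrix (Fin m) (Fin q) A,
        ((R.restrictField L σ : GL (Fin n) A) : Matrix (Fin n) (Fin n) A) =
          Matrix.reindex E E (Matrix.fromBlocks
            ((FramedRep.conj (s σ₀)⁻¹ s σ : GL (Fin m) A) : Matrix (Fin m) (Fin m) A) B 0
            ((D σ : GL (Fin q) A) : Matrix (Fin q) (Fin q) A)) := by
  haveI : CharZero L := charZero_of_injective_algebraMap (algebraMap K L).injective
  let q : ℕ := Fintype.card ({i : ι // i ≠ i₀} × Fin m)
  let e' : ({i : ι // i ≠ i₀} × Fin m) ≃ Fin q := Fintype.equivFin _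
  obtain ⟨E₁, hE₁l, hE₁r⟩ := exists_blockSplitEquiv i₀ (Fin m)
  let E₀ : Fin m ⊕ Fin q ≃ ι × Fin m := (Equiv.sumCongr (Equiv.refl (Fin m)) e'.symm).trans E₁
  let E : Fin m ⊕ Fin q ≃ Fin n := E₀.trans e
  -- membership of the representatives in `res(Γ_L)`
  have hmem : ∀ i : ι, t i ∈ (absGaloisRestrict K L).toMonoidHom.range ↔ i = i₀ := by
    intro i
    constructor
    · intro h
      apply htinj
      change (t i : absoluteGaloisGroup K ⧸ (absGaloisRestrict K L).toMonoidHom.range) =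
        (t i₀ : absoluteGaloisGroup K ⧸ (absGaloisRestrict K L).toMonoidHom.range)
      rw [QuotientGroup.eq, ← hσ₀]
      exact mul_mem (inv_mem h) ⟨σ₀, rfl⟩
    · rintro rfl
      rw [← hσ₀]
      exact ⟨σ₀, rfl⟩
  have hoff : ∀ (i : ι) (σ : absoluteGaloisGroup L), i ≠ i₀ →
      (t i)⁻¹ * absGaloisRestrict K L σ * t i₀ ∉ (absGaloisRestrict K L).toMonoidHom.range := by
    intro i σ hne h
    apply hne
    rw [← hmem i]
    have h1 := mul_mem (mul_mem h (inv_mem ((hmem i₀).2 rfl))) (inv_mem (⟨σ, rfl⟩ :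
      absGaloisRestrict K L σ ∈ (absGaloisRestrict K L).toMonoidHom.range))
    rw [show (t i)⁻¹ * absGaloisRestrict K L σ * t i₀ * (t i₀)⁻¹ * (absGaloisRestrict K L σ)⁻¹ =
      (t i)⁻¹ by group] at h1
    exact inv_mem_iff.1 h1
  -- the entries of `R(res σ)` in the relabelling `E`
  have hentry : ∀ (σ : absoluteGaloisGroup L) (x y : Fin m ⊕ Fin q),
      ((R.restrictField L σ : GL (Fin n) A) : Matrix (Fin n) (Fin n) A) (E x) (E y) =
        dotExtend (absGaloisRestrict K L).toMonoidHom (FramedRep.toMatrixHom s)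
          ((t (E₀ x).1)⁻¹ * absGaloisRestrict K L σ * t (E₀ y).1) (E₀ x).2 (E₀ y).2 := by
    intro σ x y
    rw [FramedGaloisRep.restrictField_apply, hR]
    simp only [E, Matrix.reindex_apply, Matrix.submatrix_apply, Equiv.trans_apply,
      Equiv.symm_apply_apply, Matrix.comp_apply, indMatrix_apply]
  have h21 : ∀ σ : absoluteGaloisGroup L, Matrix.toBlocks₂₁
      (((R.restrictField L σ : GL (Fin n) A) : Matrix (Fin n) (Fin n) A).submatrix E E) = 0 := by
    intro σ
    ext c b
    simp only [Matrix.toBlocks₂₁, Matrix.of_apply, Matrix.submatrix_apply, Matrix.zero_apply]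
    have hne : (E₀ (Sum.inr c)).1 ≠ i₀ := by
      simpa [E₀, hE₁r] using (e'.symm c).1.2
    have hi0 : (E₀ (Sum.inl b)).1 = i₀ := by simp [E₀, hE₁l]
    rw [hentry, hi0, dotExtend_of_not_mem _ _ (hoff _ σ hne), Matrix.zero_apply]
  have h11 : ∀ σ : absoluteGaloisGroup L, Matrix.toBlocks₁₁
      (((R.restrictField L σ : GL (Fin n) A) : Matrix (Fin n) (Fin n) A).submatrix E E) =
        ((FramedRep.conj (s σ₀)⁻¹ s σ : GL (Fin m) A) : Matrix (Fin m) (Fin m) A) := by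
    intro σ
    ext a b
    simp only [Matrix.toBlocks₁₁, Matrix.of_apply, Matrix.submatrix_apply]
    rw [hentry]
    have ha : E₀ (Sum.inl a) = (i₀, a) := by simp [E₀, hE₁l]
    have hb : E₀ (Sum.inl b) = (i₀, b) := by simp [E₀, hE₁l]
    rw [ha, hb]
    change dotExtend (absGaloisRestrict K L).toMonoidHom (FramedRep.toMatrixHom s)
      ((t i₀)⁻¹ * absGaloisRestrict K L σ * t i₀) a b = _
    have h1 : (t i₀)⁻¹ * absGaloisRestrict K L σ * t i₀ =
        (absGaloisRestrict K L).toMonoidHom (σ₀⁻¹ * σ * σ₀) := by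
      rw [← hσ₀]
      change _ = absGaloisRestrict K L (σ₀⁻¹ * σ * σ₀)
      rw [map_mul, map_mul, map_inv]
    rw [h1, dotExtend_apply_map (absGaloisRestrict_injective K L), FramedRep.toMatrixHom_apply,
      FramedRep.conj_apply, map_mul, map_mul, map_inv, inv_inv, Units.val_mul, Units.val_mul]
  obtain ⟨D, hD⟩ := FramedRep.exists_eq_reindex_fromBlocks (R.restrictField L) E h21
  refine ⟨q, E, D, fun σ =>
    ⟨Matrix.toBlocks₁₂
      (((R.restrictField L σ : GL (Fin n) A) : Matrix (Fin n) (Fin n) A).submatrix E E), ?_⟩⟩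
  have h := hD σ
  rwa [h11 σ] at h

end Corner

/-! ### §2 Geometricity of the inducing representation -/

section Geometric

variable (K L : Type) [Field K] [NumberField K] [Field L] [NumberField L] [Algebra K L]

set_option backward.isDefEq.respectTransparency false in
/-- **The inducing representation of a geometric induced representation is geometric** (any
finite `L/K`): if `Q ρ Q⁻¹ = e·Ind_{Γ_L}^{Γ_K}(σ)·e⁻¹` (matrix form `indMatrix` for a transversal
`t`) and `ρ` is unramified at almost all places of `K` and de Rham at every `v ∣ ℓ`, then `σ` is
unramified at almost all places of `L` and de Rham at every `w ∣ ℓ`: `σ(σ₀)⁻¹ σ σ(σ₀)` is the corner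
of `(QρQ⁻¹)|_{Γ_L}` (§1), and corners inherit both properties
(`PstWeilDeligneData.isDeRhamFramed_blocks`, `DeRhamBaseChange_holds`).
[cite: FontaineAsterisque223III, Exp. III Prop. 1.5.2] [cite: BrinonConrad2009, Prop. 6.3.8]
[cite: SerreAbelianLadic1968, Ch. I §2.1] -/
theorem isUnramifiedAt_and_isDeRhamFramed_of_conj_eq_reindex_comp_indMatrix
    {ℓ : ℕ} [Fact ℓ.Prime] {n m : ℕ} (ρ : FramedGaloisRep K (PadicAlgCl ℓ) n)
    (s : FramedGaloisRep L (PadicAlgCl ℓ) m) (Q : GL (Fin n) (PadicAlgCl ℓ))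
    {ι : Type*} [Fintype ι] [DecidableEq ι] (t : ι → absoluteGaloisGroup K)
    (ht : Function.Bijective fun i =>
      (t i : absoluteGaloisGroup K ⧸ (absGaloisRestrict K L).toMonoidHom.range))
    (e : ι × Fin m ≃ Fin n)
    (hconj : ∀ x : absoluteGaloisGroup K,
      ((FramedRep.conj Q ρ x : GL (Fin n) (PadicAlgCl ℓ)) : Matrix (Fin n) (Fin n) (PadicAlgCl ℓ)) =
        Matrix.reindex e e (Matrix.comp ι ι (Fin m) (Fin m) (PadicAlgCl ℓ)
          (indMatrix (absGaloisRestrict K L).toMonoidHom (FramedRep.toMatrixHom s) t x)))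
    (hunr : ∀ᶠ v : HeightOneSpectrum (𝓞 K) in cofinite, ρ.IsUnramifiedAt v)
    (hdR : ∀ (v : HeightOneSpectrum (𝓞 K)) (hv : ((ℓ : ℕ) : 𝓞 K) ∈ v.asIdeal),
      (fontainePstAdicCompletion v ℓ hv).IsDeRhamFramed (ρ.toLocal v)) :
    (∀ᶠ w : HeightOneSpectrum (𝓞 L) in cofinite, s.IsUnramifiedAt w) ∧
      ∀ (w : HeightOneSpectrum (𝓞 L)) (hw : ((ℓ : ℕ) : 𝓞 L) ∈ w.asIdeal),
        (fontainePstAdicCompletion w ℓ hw).IsDeRhamFramed (s.toLocal w) := by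
  haveI : CharZero L := charZero_of_injective_algebraMap (algebraMap K L).injective
  -- the index `i₀` of the trivial coset and `σ₀` with `res σ₀ = t i₀`
  obtain ⟨i₀, hi₀⟩ := ht.2
    ((1 : absoluteGaloisGroup K) : absoluteGaloisGroup K ⧸ (absGaloisRestrict K L).toMonoidHom.range)
  obtain ⟨σ₀, hσ₀⟩ : t i₀ ∈ (absGaloisRestrict K L).toMonoidHom.range := by
    have h := QuotientGroup.eq.1 hi₀
    rw [mul_one] at h
    exact inv_mem_iff.1 h
  obtain ⟨q, E, D, hblock⟩ := exists_restrictField_eq_reindex_fromBlocks_corner K L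
    (FramedRep.conj Q ρ) s t ht.1 e hconj (i₀ := i₀) (σ₀ := σ₀) hσ₀
  refine ⟨?_, fun w hw => ?_⟩
  · -- unramified almost everywhere
    have h1 : ∀ᶠ v : HeightOneSpectrum (𝓞 K) in cofinite,
        FramedGaloisRep.IsUnramifiedAt v (FramedRep.conj Q ρ) :=
      hunr.mono fun v hv => (FramedGaloisRep.isUnramifiedAt_conj_iff v Q ρ).2 hv
    have h2 : ∀ᶠ w : HeightOneSpectrum (𝓞 L) in cofinite,
        (FramedGaloisRep.restrictField L (FramedRep.conj Q ρ)).IsUnramifiedAt w :=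
      ((HeightOneSpectrum.tendsto_under_cofinite (𝓞 K) (B := 𝓞 L)).eventually h1).mono
        fun _ hw => FramedGaloisRep.isUnramifiedAt_restrictField _ rfl hw
    refine h2.mono fun w hw => ?_
    rw [← FramedGaloisRep.isUnramifiedAt_conj_iff w (s σ₀)⁻¹ s]
    intro 𝔔 h𝔔 σ hσ
    obtain ⟨B, hB⟩ := hblock σ
    have h3 : ((FramedGaloisRep.restrictField L (FramedRep.conj Q ρ) σ :
        GL (Fin n) (PadicAlgCl ℓ)) : Matrix (Fin n) (Fin n) (PadicAlgCl ℓ)) = 1 := by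
      rw [hw 𝔔 h𝔔 σ hσ, Units.val_one]
    rw [hB] at h3
    have h4 := (Matrix.reindex E E).injective
      (h3.trans (by rw [Matrix.reindex_apply, Matrix.submatrix_one_equiv]))
    rw [← Matrix.fromBlocks_one, Matrix.fromBlocks_inj] at h4
    exact Units.val_eq_one.1 h4.1
  · -- de Rham at `w ∣ ℓ`
    have hRdR : (fontainePstAdicCompletion w ℓ hw).IsDeRhamFramed
        ((FramedGaloisRep.restrictField L (FramedRep.conj Q ρ)).toLocal w) := by
      refine isDeRhamFramed_toLocal_restrictField DeRhamBaseChange_holds (FramedRep.conj Q ρ)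
        (fun v hv => ?_) w hw
      rw [FramedGaloisRep.toLocal_conj, PstWeilDeligneData.isDeRhamFramed_conj_iff]
      exact hdR v hv
    have hT : ∀ g : absoluteGaloisGroup (w.adicCompletion L),
        ∃ B : Matrix (Fin m) (Fin q) (PadicAlgCl ℓ),
          (((FramedGaloisRep.restrictField L (FramedRep.conj Q ρ)).toLocal w g :
              GL (Fin n) (PadicAlgCl ℓ)) : Matrix (Fin n) (Fin n) (PadicAlgCl ℓ)) =
            Matrix.reindex E E (Matrix.fromBlocks
              ((FramedGaloisRep.toLocal w (FramedRep.conj (s σ₀)⁻¹ s) g :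
                GL (Fin m) (PadicAlgCl ℓ)) : Matrix (Fin m) (Fin m) (PadicAlgCl ℓ)) B 0
              ((D.toLocal w g : GL (Fin q) (PadicAlgCl ℓ)) :
                Matrix (Fin q) (Fin q) (PadicAlgCl ℓ))) :=
      fun g => hblock _
    have hA := ((fontainePstAdicCompletion w ℓ hw).isDeRhamFramed_blocks E hT hRdR).1
    rwa [FramedGaloisRep.toLocal_conj, PstWeilDeligneData.isDeRhamFramed_conj_iff] at hA

end Geometric

/-! ### §3 Case A of the Clifford–Tate structure theorem -/

section CaseA

set_option backward.isDefEq.respectTransparency false in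
/-- **Clifford–Tate structure, induced case.**  Let `ρ : Γ_K → GL_n(ℚ̄_ℓ)` be irreducible,
unramified almost everywhere and de Rham at `ℓ`, and let `(U, H)` be a system of imprimitivity
for `ρ` with `H` an OPEN PROPER subgroup of `Γ_K`: `U ≠ 0`, `ρ(g) U = U ↔ g ∈ H`, the translates
`ρ(g) U` independent and spanning `ℚ̄_ℓⁿ`.  Then for the number field `L = K̄^H` (`[L : K] =
[Γ_K : H] ≥ 2`) there is an irreducible `σ : Γ_L → GL_m(ℚ̄_ℓ)`, `n = [L : K]·m`, unramified almost
everywhere and de Rham at `ℓ`, with `charpoly ρ(g) = charpoly Ind_{Γ_L}^{Γ_K}(σ)(g)` for every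
`g ∈ Γ_K` (indeed `ρ ≅ Ind σ`).  [cite: Clifford1937, Thm. 1–2]
[cite: SerreLinearRepresentations1977, §7.1 Prop. 19, §7.2] [cite: SerreAbelianLadic1968, Ch. I §2.1] -/
theorem exists_induce_of_imprimitivity (K : Type) [Field K] [NumberField K] (n : ℕ) (ℓ : ℕ)
    [Fact ℓ.Prime] (ρ : FramedGaloisRep K (PadicAlgCl ℓ) n) (hirr : ρ.toGaloisRep.IsIrreducible)
    (hgeo : (∀ᶠ v : HeightOneSpectrum (𝓞 K) in cofinite, ρ.IsUnramifiedAt v) ∧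
      ∀ (v : HeightOneSpectrum (𝓞 K)) (hv : ((ℓ : ℕ) : 𝓞 K) ∈ v.asIdeal),
        (fontainePstAdicCompletion v ℓ hv).IsDeRhamFramed (ρ.toLocal v))
    (H : Subgroup (absoluteGaloisGroup K)) (hHo : IsOpen (H : Set (absoluteGaloisGroup K)))
    (hHt : H ≠ ⊤) (U : Submodule (PadicAlgCl ℓ) (Fin n → PadicAlgCl ℓ)) (hUb : U ≠ ⊥)
    (hstab : ∀ g : absoluteGaloisGroup K, U.map (FramedRep.toRepresentation ρ g) = U ↔ g ∈ H)
    (hind : sSupIndep (Set.range fun g : absoluteGaloisGroup K =>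
      U.map (FramedRep.toRepresentation ρ g)))
    (hsup : ⨆ g : absoluteGaloisGroup K, U.map (FramedRep.toRepresentation ρ g) = ⊤) :
    ∃ (L : Type) (_ : Field L) (_ : NumberField L) (_ : Algebra K L) (m : ℕ)
      (σ : FramedGaloisRep L (PadicAlgCl ℓ) m),
      2 ≤ Module.finrank K L ∧ n = Module.finrank K L * m ∧ σ.toGaloisRep.IsIrreducible ∧
      ((∀ᶠ v : HeightOneSpectrum (𝓞 L) in cofinite, σ.IsUnramifiedAt v) ∧
        ∀ (v : HeightOneSpectrum (𝓞 L)) (hv : ((ℓ : ℕ) : 𝓞 L) ∈ v.asIdeal),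
          (fontainePstAdicCompletion v ℓ hv).IsDeRhamFramed (σ.toLocal v)) ∧
      ∀ g : absoluteGaloisGroup K, FramedRep.charpoly ρ g =
        FramedRep.charpoly (σ.induce K (rfl : Module.finrank K L = Module.finrank K L)) g := by
  classical
  let M : IntermediateField K (AlgebraicClosure K) := IntermediateField.fixedField H
  haveI hMfd : FiniteDimensional K M := finiteDimensional_fixedField_of_isOpen H hHo
  haveI : NumberField M := NumberField.of_module_finite K M
  have hdx : Module.finrank K M = H.index := finrank_fixedField_of_isOpen H hHo
  have h2 : 2 ≤ Module.finrank K M := by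
    rw [hdx]
    have h1 : H.index ≠ 1 := fun h => hHt (Subgroup.index_eq_one.1 h)
    have h0 : H.index ≠ 0 := by
      rw [← hdx]
      exact Module.finrank_pos.ne'
    omega
  obtain ⟨g, hg⟩ := exists_mem_range_absGaloisRestrict_fixedField_iff H hHo
  -- translate the system of imprimitivity to `U' = ρ(g) U`, whose stabiliser is `res(Γ_L)`
  have hstab' : ∀ x : absoluteGaloisGroup K,
      (U.map (FramedRep.toRepresentation ρ g)).map (FramedRep.toRepresentation ρ x) =
        U.map (FramedRep.toRepresentation ρ g) ↔ x ∈ (absGaloisRestrict K M).toMonoidHom.range :=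
    fun x => stabiliser_translate hstab (absGaloisRestrict K M).toMonoidHom.range g (fun γ => hg γ) x
  have hind' : sSupIndep (Set.range fun x : absoluteGaloisGroup K =>
      (U.map (FramedRep.toRepresentation ρ g)).map (FramedRep.toRepresentation ρ x)) := by
    rw [range_map_translate]
    exact hind
  have hsup' : ⨆ x : absoluteGaloisGroup K,
      (U.map (FramedRep.toRepresentation ρ g)).map (FramedRep.toRepresentation ρ x) = ⊤ := by
    rw [iSup_map_translate]
    exact hsup
  have hU'b : U.map (FramedRep.toRepresentation ρ g) ≠ ⊥ := by
    intro h
    apply hUb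
    have h1 := congrArg (Submodule.map (FramedRep.toRepresentation ρ g⁻¹)) h
    rwa [Submodule.map_bot, ← Submodule.map_comp, ← Module.End.mul_eq_comp, ← map_mul,
      inv_mul_cancel, map_one, Module.End.one_eq_id, Submodule.map_id] at h1
  -- `Q ρ Q⁻¹ = e·Ind(σ)·e⁻¹`
  obtain ⟨s, Q, e, hsirr, hconj⟩ := exists_conj_eq_reindex_comp_indMatrix_of_isInducedFrom ρ hirr
    (absGaloisRestrict K M) (absGaloisRestrict_injective K M) _ hU'b hstab' hind' hsup'
    (absGaloisCosetRep K M rfl) (absGaloisCosetRep_bijective K M rfl)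
  refine ⟨M, inferInstance, inferInstance, inferInstance, _, s, h2, ?_, hsirr, ?_, fun x => ?_⟩
  · -- `n = [L : K] · m`
    have h1 := Fintype.card_congr e
    simp only [Fintype.card_prod, Fintype.card_fin] at h1
    exact h1.symm
  · -- geometricity of `σ`
    exact isUnramifiedAt_and_isDeRhamFramed_of_conj_eq_reindex_comp_indMatrix K M ρ s Q
      (absGaloisCosetRep K M rfl) (absGaloisCosetRep_bijective K M rfl) e hconj hgeo.1 hgeo.2
  · -- characteristic polynomials
    have h1 : FramedRep.charpoly ρ x = FramedRep.charpoly (FramedRep.conj Q ρ) x := by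
      simp only [FramedRep.charpoly, FramedRep.conj_apply, Units.val_mul, Matrix.coe_units_inv]
      exact (Matrix.charpoly_units_conj Q _).symm
    rw [h1, FramedRep.charpoly, hconj x, FramedRep.charpoly, FramedGaloisRep.induce_def,
      FramedRep.induce_apply_coe, FramedRep.indFlatHom_apply_eq_reindex, Matrix.charpoly_reindex,
      Matrix.charpoly_reindex]

end CaseA

end Summit.Langlands.Langlands.Theorems

end
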